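import Literature.Probability.Percolation.ExtArmsOn
import Literature.Probability.Percolation.SepArmsOnInwardExt
import Literature.Probability.Percolation.SepArmsOnQuasiMult
import Literature.Probability.Percolation.ArmSeparationInScheme
import HarnessLib

/-!
# Nolin's induction on scales for an arbitrary arm pattern: separation from the two surgeries

Topic: Probability / Percolation; family `crit-perc` (critical site percolation on the triangular
lattice `𝕋`; hexagonal annuli `Λ_N ∖ Λ_n`). A brick toward the named fact
`Literature.Probability.Percolation.Nolin2008_prop17_quasiMult` (P. Nolin, *Near-critical
percolation in two dimensions*, EJP 13 (2008), §4.5 Prop. 17 [arXiv 0711.4948: Prop. 16]):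
quasi-multiplicativity of the `k`-arm probabilities `polyArmProb κ` follows
(`polyArmProb_quasiMult_of_sepArmsOn_separation`, `SepArmsOnQuasiMult.lean`) from Nolin's
arm-separation theorem (Thm. 11 [arXiv Thm. 10]) for the pattern — `k` arms of colours
`κ : Fin k → Bool` landing fenced on the pairwise distinct sides `s : Fin k → Fin 6` (`sepArmsOn κ s`,
`SepArmsOnGlue.lean`). Nolin proves Thm. 11 (§4.4 pp. 11–13) by an induction on dyadic scales, in
two halves (external extremities, then internal ones), each fed by four inputs: a SURGERY in a good
annulus with small failure probability ("Lemma 14 … with probability `≥ 1 - δ` any set of disjoint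
crossings can be made `η'`-well-separated"), a LANDING at constant cost `C₁(η')C₂(η')` onto the
macroscopic landing sequence, the EXTENSION of landed arms at constant cost `C₀` (Prop. 12 (i),
Lemma 13), and the INITIAL estimate at bounded ratio; the summation is the tree's
`le_mul_of_separationScheme_upto` ("we may have taken `δ` such that `4 δ C₀ < 1/2`").

For an ARBITRARY pattern `(κ, s)` the extension and initial inputs of both halves are in the tree
(`exists_real_extArmsOn_mul_le_outward`, `pow_le_real_extArmsOn_smallRatio_at` — `ExtArmsOn.lean`;
`exists_real_sepArmsOn_mul_le_inward` — `SepArmsOnInwardExt.lean`;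
`exists_le_real_sepArmsOn_smallRatio` — `SepArmsOnSmallRatio.lean`). This file runs Nolin's
induction for an arbitrary pattern ASSUMING only the two pattern-specific inputs, stated as
hypotheses of the exact shape the four-arm developments prove them in
(`real_altFourArm_le_outStepFr_at` + `real_not_outGoodFr_le_at` + `real_outMidTiny4_le_at` for the
external half, `real_extFourArmQ_le_step4_at` + `real_not_inGoodF_le_at` + `real_intTinyExt4_le_at`
for the internal half):

* `exists_real_le_mul_extArmsOn_of_outerSurgery` — **external half**: for an event `A n R`
  antitone in `R`, if for every `ε > 0` there are fine-landed events `G n M`, a constant `C₁` and a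
  threshold `n₀` with `P(A n (2M)) ≤ P(G n M) + ε P(A n M)` (surgery in the annulus `(M, 2M)`,
  failure `≤ ε`, independence) and `P(G n M) ≤ C₁ P(extArmsOn κ s n (4M))` (landing on the next
  scale), then `P(A n N) ≤ C P(extArmsOn κ s n N)` for `n ≥ n₀'`, `N ≥ 2n`;
* `exists_real_extArmsOn_le_mul_sepArmsOn_of_innerSurgery` — **internal half**: if for every
  `ε > 0` there are `G, C₁, n₀` with `P(extArmsOn κ s m N) ≤ P(G m N) + ε P(extArmsOn κ s (2m+1) N)`
  and `P(G (2m+1) N) ≤ C₁ P(sepArmsOn κ s m N)` (`2(2m+1) ≤ N`), then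
  `P(extArmsOn κ s n N) ≤ C P(sepArmsOn κ s n N)` for `n ≥ n₀'`, `N ≥ 2n` (the ladder
  `m_j = (n+1)2^j - 1`, `inRad`);
* `sepArmsOn_separation_of_surgeries` — both halves for `A = armEvent κ`: the separation
  hypothesis `hsep` of `SepArmsOnQuasiMult.lean`; `polyArmProb_quasiMult_of_surgeries` — hence
  quasi-multiplicativity of `polyArmProb κ` (the clause of `Nolin2008_prop17_quasiMult` at `κ`).

Everything at `p = 1/2`; everything here is PROVED; no definition and no named fact is introduced.

## References

* P. Nolin, *Near-critical percolation in two dimensions*, Electron. J. Probab. 13 (2008),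
  1562–1623, §4.4 (proof of Thm. 11, pp. 11–13), §4.5 Prop. 17 [arXiv 0711.4948: Thm. 10,
  Lemma 14, Prop. 16]. [Nolin2008]
* H. Kesten, *Scaling relations for 2D-percolation*, Comm. Math. Phys. 109 (1987), Lemma 2. [Kesten1987]
* O. Schramm, J. Steif, *Quantitative noise sensitivity and exceptional times for percolation*,
  Ann. Math. 171 (2010), Appendix A, Lemma A.4. [SchrammSteif2010]

Tree: `le_mul_of_separationScheme_upto` (`ArmSeparationSchemeFin.lean`); `inRad`, `inRad_zero`,
`inRad_succ`, `two_mul_inRad`, `le_inRad`, `inRad_mono` (`ArmSeparationInScheme.lean`);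
`exists_real_altFourArm_le_mul_extFourArmQ_at`, `exists_real_extFourArmQ_le_mul_sepFourArmG_at`
(the four-arm instances, whose bookkeeping is copied here); `extArmsOn`, `sepArmsOn_subset_extArmsOn`,
`exists_real_extArmsOn_mul_le_outward` (`ExtArmsOn.lean`); `exists_real_sepArmsOn_mul_le_inward`
(`SepArmsOnInwardExt.lean`); `exists_le_real_sepArmsOn_smallRatio` (`SepArmsOnSmallRatio.lean`);
`extOpenArm_mono` (`ArmSeparationExtArm.lean`); `armEvent_mono_holds` (`ArmEventsProofs.lean`);
`polyArmProb_quasiMult_of_sepArmsOn_separation` (`SepArmsOnQuasiMult.lean`).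
-/

noncomputable section

open MeasureTheory Set

namespace Literature.Probability.Percolation

open LatticeModels

variable {k : ℕ}

/-! ### Monotonicity of the outer-landed event in the inner radius -/

/-- **A longer outer-landed `k`-arm event contains a shorter one**: `extArmsOn κ s n N ⊆ extArmsOn κ s n' N`
for `n ≤ n' ≤ N` (`extOpenArm_mono` arm by arm, same carriers). [folklore] -/
theorem extArmsOn_mono (κ : Fin k → Bool) (s : Fin k → Fin 6) {n n' N : ℕ} (hnn' : n ≤ n') (hn'N : n' ≤ N) :
    extArmsOn κ s n N ⊆ extArmsOn κ s n' N := by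
  rintro ω ⟨X, hX, hA⟩
  exact ⟨X, hX, fun j => extOpenArm_mono hnn' hn'N (hA j)⟩

/-! ### The external half -/

/-- **Nolin's induction on scales, external extremities, for an arbitrary pattern** (Nolin 2008,
proof of Thm. 11, §4.4 pp. 11–13 [arXiv 0711.4948: Thm. 10]): let `A n R` be events antitone in
`R ≥ 2n` (the arms from `∂Λ_n` to `∂Λ_R`). Suppose that for every `ε > 0` there are events
`G n M`, a constant `C₁ ≥ 0` and a threshold `n₀` such that for `n ≥ n₀`, `M ≥ 2n`:
`P(A n (2M)) ≤ P(G n M) + ε · P(A n M)` (surgery in the annulus `(M, 2M)` with failure probability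
`≤ ε`, by independence) and `P(G n M) ≤ C₁ · P(extArmsOn κ s n (4M))` (landing of the fine-landed
event on the next scale). Then there are `C > 0`, `n₀'` with
`P(A n N) ≤ C · P(extArmsOn κ s n N)` for `n ≥ n₀'`, `N ≥ 2n` (at `p = 1/2`). Proof: the outward
extension constant `C₀ = 1/c₁` (`exists_real_extArmsOn_mul_le_outward`), `ε = 1/(2C₀²)`, the
doubling ladder `R_K = 2n·2^K` and `le_mul_of_separationScheme_upto` with the initial estimate
`exists_le_real_sepArmsOn_smallRatio`; from the top of the ladder to `N` by one more extension. [cite: Nolin2008, §4.4 Thm. 11 (arXiv 0711.4948: Thm. 10, pp. 11–13), external extremities] -/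
theorem exists_real_le_mul_extArmsOn_of_outerSurgery (κ : Fin k → Bool) (s : Fin k → Fin 6)
    (hs : Function.Injective s) (A : ℕ → ℕ → Set (SiteConfig (Site 2)))
    (hA : ∀ n R R' : ℕ, 2 * n ≤ R → R ≤ R' → A n R' ⊆ A n R)
    (hOut : ∀ ε : ℝ, 0 < ε → ∃ (G : ℕ → ℕ → Set (SiteConfig (Site 2))) (C₁ : ℝ) (n₀ : ℕ), 0 ≤ C₁ ∧
      (∀ n M : ℕ, n₀ ≤ n → 2 * n ≤ M →
        (triSitePercolation half).real (A n (2 * M)) ≤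
          (triSitePercolation half).real (G n M) + ε * (triSitePercolation half).real (A n M)) ∧
      (∀ n M : ℕ, n₀ ≤ n → 2 * n ≤ M →
        (triSitePercolation half).real (G n M) ≤ C₁ * (triSitePercolation half).real (extArmsOn κ s n (4 * M)))) :
    ∃ C : ℝ, 0 < C ∧ ∃ n₀ : ℕ, ∀ n N : ℕ, n₀ ≤ n → 2 * n ≤ N →
      (triSitePercolation half).real (A n N) ≤ C * (triSitePercolation half).real (extArmsOn κ s n N) := by
  classical
  set μ := triSitePercolation half with hμ
  have hP1 : ∀ t : Set (SiteConfig (Site 2)), μ.real t ≤ 1 := fun t => measureReal_le_one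
  have hP0 : ∀ t : Set (SiteConfig (Site 2)), 0 ≤ μ.real t := fun t => measureReal_nonneg
  -- the extension constant `C₀`
  obtain ⟨c₁, hc₁, hext⟩ := exists_real_extArmsOn_mul_le_outward κ s hs
  set c₁' : ℝ := min c₁ 1 with hc₁'
  have hc₁'0 : 0 < c₁' := lt_min hc₁ one_pos
  have hc₁'1 : c₁' ≤ 1 := min_le_right _ _
  set C₀ : ℝ := 1 / c₁' with hC₀
  have hC₀1 : 1 ≤ C₀ := by rw [hC₀, le_div_iff₀ hc₁'0, one_mul]; exact hc₁'1
  have hC₀0 : 0 < C₀ := lt_of_lt_of_le one_pos hC₀1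
  have hextC : ∀ n R R', 2200 ≤ R → 2 * n ≤ R → 2 * R ≤ R' → R' ≤ 32 * R →
      μ.real (extArmsOn κ s n R) ≤ C₀ * μ.real (extArmsOn κ s n R') := by
    intro n R R' h1 h2 h3 h4
    rw [hC₀, one_div, ← div_eq_inv_mul, le_div_iff₀ hc₁'0]
    exact (mul_le_mul_of_nonneg_left (min_le_left _ _) (hP0 _)).trans (hext n R R' h1 h2 h3 h4)
  -- the failure rate
  set ε : ℝ := 1 / (2 * C₀ ^ 2) with hε
  have hε0 : 0 < ε := by positivity
  have hεC : ε * C₀ ^ 2 ≤ 1 / 2 := by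
    have hne : C₀ ≠ 0 := hC₀0.ne'
    have e : ε * C₀ ^ 2 = 1 / 2 := by rw [hε]; field_simp
    rw [e]
  obtain ⟨G, C₁, n₁, hC₁, hstep, hland⟩ := hOut ε hε0
  -- the initial estimate
  obtain ⟨ci, hci0, hinit0⟩ := exists_le_real_sepArmsOn_smallRatio κ s hs
  have hinit : ∀ n N', 1100 ≤ n → 2 * n ≤ N' → N' ≤ 256 * n → ci ≤ μ.real (extArmsOn κ s n N') :=
    fun n N' h1 h2 h3 => (hinit0 n N' h1 h2 h3).trans
      (measureReal_mono (sepArmsOn_subset_extArmsOn κ s h2) (measure_ne_top _ _))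
  set Cs : ℝ := 2 * C₁ + 1 / ci with hCs
  have hCs0 : 0 < Cs := by positivity
  refine ⟨Cs * C₀ + 1 / ci, by positivity, n₁ + 1100, fun n N hn hN => ?_⟩
  have hn1100 : 1100 ≤ n := le_trans (Nat.le_add_left _ _) hn
  have hnn₁ : n₁ ≤ n := le_trans (Nat.le_add_right _ _) hn
  -- small `N`: the initial estimate alone
  by_cases hsmallN : N < 8 * n
  · have h1 : ci ≤ μ.real (extArmsOn κ s n N) := hinit n N hn1100 hN (by omega)
    have h2 : 1 ≤ 1 / ci * μ.real (extArmsOn κ s n N) := by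
      rw [one_div, inv_mul_eq_div, le_div_iff₀ hci0]; linarith
    calc μ.real (A n N) ≤ 1 := hP1 _
      _ ≤ 1 / ci * μ.real (extArmsOn κ s n N) := h2
      _ ≤ (Cs * C₀ + 1 / ci) * μ.real (extArmsOn κ s n N) := by
          have := hP0 (extArmsOn κ s n N); have : 0 ≤ Cs * C₀ := by positivity
          nlinarith
  push Not at hsmallN
  -- the ladder `ρ K' = 2n · 2^K'` and its top `L ≥ 1` with `2 ρ L ≤ N < 4 ρ L`
  set ρ : ℕ → ℕ := fun K' => 2 * n * 2 ^ K' with hρ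
  have hρsucc : ∀ K', ρ (K' + 1) = 2 * ρ K' := fun K' => by simp only [hρ, pow_succ]; ring
  have hρn : ∀ K', 2 * n ≤ ρ K' := fun K' => by
    simp only [hρ]; exact Nat.le_mul_of_pos_right _ (Nat.one_le_two_pow)
  have hρmono : ∀ K', ρ K' ≤ ρ (K' + 1) := fun K' => by rw [hρsucc]; omega
  have hex : ∃ j, N < 2 * ρ (j + 1) := by
    refine ⟨N, ?_⟩
    simp only [hρ]
    have h2 : N + 1 < 2 ^ (N + 1) := Nat.lt_two_pow_self
    have h3 : 1 ≤ 2 * n := by omega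
    calc N < 2 ^ (N + 1) := by omega
      _ ≤ 2 * n * 2 ^ (N + 1) := Nat.le_mul_of_pos_left _ h3
      _ ≤ 2 * (2 * n * 2 ^ (N + 1)) := Nat.le_mul_of_pos_left _ (by norm_num)
  set L := Nat.find hex with hL
  have hLspec : N < 2 * ρ (L + 1) := Nat.find_spec hex
  have hL1 : 1 ≤ L := by
    by_contra h
    have hL0 : L = 0 := by omega
    rw [hL0, zero_add] at hLspec
    simp only [hρ, pow_one] at hLspec
    omega
  have hLle : 2 * ρ L ≤ N := by
    have := Nat.find_min hex (show L - 1 < L by omega)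
    rw [show L - 1 + 1 = L by omega] at this
    omega
  have hρLN : ρ L ≤ N := by omega
  have hNρ : N ≤ 32 * ρ L := by rw [hρsucc] at hLspec; omega
  -- the three sequences and the scheme
  set f : ℕ → ℝ := fun K' => μ.real (A n (ρ K')) with hf
  set g : ℕ → ℝ := fun K' => μ.real (G n (ρ (K' - 1))) with hg
  set h : ℕ → ℝ := fun K' => μ.real (extArmsOn κ s n (ρ K')) with hh
  have key := le_mul_of_separationScheme_upto (f := f) (g := g) (h := h) (k := 0) (L := L) hε0.le hC₀1 hC₁ hci0 hεC
    (fun K' => hP1 _) (fun K' => hP0 _) (by omega)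
    (fun K' _ _ => measureReal_mono (hA n (ρ K') (ρ (K' + 1)) (hρn K') (hρmono K')) (measure_ne_top _ _))
    (fun K' _ _ => by
      show μ.real (A n (ρ (K' + 1))) ≤ μ.real (G n (ρ (K' + 1 - 1))) + ε * μ.real (A n (ρ K'))
      rw [Nat.add_sub_cancel, hρsucc]
      exact hstep n (ρ K') hnn₁ (hρn K'))
    (fun K' hK' _ => by
      show μ.real (G n (ρ (K' - 1))) ≤ C₁ * μ.real (extArmsOn κ s n (ρ (K' + 1)))
      have h4 : ρ (K' + 1) = 4 * ρ (K' - 1) := by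
        rw [show K' + 1 = (K' - 1) + 1 + 1 by omega, hρsucc, hρsucc]; ring
      rw [h4]
      exact hland n (ρ (K' - 1)) hnn₁ (hρn (K' - 1)))
    (fun K' _ _ => by
      show μ.real (extArmsOn κ s n (ρ K')) ≤ C₀ * μ.real (extArmsOn κ s n (ρ (K' + 1)))
      have h2200 : 2200 ≤ ρ K' := by have := hρn K'; omega
      exact hextC n (ρ K') (ρ (K' + 1)) h2200 (hρn K') (by rw [hρsucc]) (by rw [hρsucc]; omega))
    (by
      show ci ≤ μ.real (extArmsOn κ s n (ρ (0 + 1)))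
      have hρ1 : ρ (0 + 1) = 4 * n := by simp only [hρ, zero_add, pow_one]; ring
      rw [hρ1]
      exact hinit n (4 * n) hn1100 (by omega) (by omega))
    L hL1 le_rfl
  simp only [hf, hh] at key
  -- from `ρ L` to `N`
  have h2200 : 2200 ≤ ρ L := by have := hρn L; omega
  have e1 : μ.real (A n N) ≤ μ.real (A n (ρ L)) := measureReal_mono (hA n (ρ L) N (hρn L) hρLN) (measure_ne_top _ _)
  have e2 : μ.real (extArmsOn κ s n (ρ L)) ≤ C₀ * μ.real (extArmsOn κ s n N) := hextC n (ρ L) N h2200 (hρn L) hLle hNρ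
  have e3 : 0 ≤ μ.real (extArmsOn κ s n N) := hP0 _
  calc μ.real (A n N) ≤ Cs * μ.real (extArmsOn κ s n (ρ L)) := e1.trans key
    _ ≤ Cs * (C₀ * μ.real (extArmsOn κ s n N)) := mul_le_mul_of_nonneg_left e2 hCs0.le
    _ ≤ (Cs * C₀ + 1 / ci) * μ.real (extArmsOn κ s n N) := by
        have : 0 ≤ 1 / ci * μ.real (extArmsOn κ s n N) := by positivity
        nlinarith

/-! ### The internal half -/

/-- **Nolin's induction on scales, internal extremities, for an arbitrary pattern** (Nolin 2008,
proof of Thm. 11, §4.4 p. 13, "the reasoning is the same for internal extremities"): suppose that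
for every `ε > 0` there are events `G m N`, a constant `C₁ ≥ 0` and a threshold `n₀` such that for
`m ≥ n₀`, `2(2m+1) ≤ N`: `P(extArmsOn κ s m N) ≤ P(G m N) + ε · P(extArmsOn κ s (2m+1) N)` (surgery
in the annulus `(m, 2m+1)`) and `P(G (2m+1) N) ≤ C₁ · P(sepArmsOn κ s m N)` (landing of the rung
`2m+1` onto `∂Λ_m`). Then there are `C > 0`, `n₀'` with `P(extArmsOn κ s n N) ≤ C · P(sepArmsOn κ s n N)`
for `n ≥ n₀'`, `N ≥ 2n` (at `p = 1/2`). Proof: the inward extension constant `C₀ = 1/c₁`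
(`exists_real_sepArmsOn_mul_le_inward`), `ε = 1/(2C₀²)`, the ladder `m_j = (n+1)2^j - 1` (`inRad`)
read inward and `le_mul_of_separationScheme_upto` with the initial estimate
`exists_le_real_sepArmsOn_smallRatio`. [cite: Nolin2008, §4.4 Thm. 11 (arXiv 0711.4948: Thm. 10, p. 13), internal extremities] -/
theorem exists_real_extArmsOn_le_mul_sepArmsOn_of_innerSurgery (κ : Fin k → Bool) (s : Fin k → Fin 6)
    (hs : Function.Injective s)
    (hIn : ∀ ε : ℝ, 0 < ε → ∃ (G : ℕ → ℕ → Set (SiteConfig (Site 2))) (C₁ : ℝ) (n₀ : ℕ), 0 ≤ C₁ ∧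
      (∀ m N : ℕ, n₀ ≤ m → 2 * (2 * m + 1) ≤ N →
        (triSitePercolation half).real (extArmsOn κ s m N) ≤
          (triSitePercolation half).real (G m N) + ε * (triSitePercolation half).real (extArmsOn κ s (2 * m + 1) N)) ∧
      (∀ m N : ℕ, n₀ ≤ m → 2 * (2 * m + 1) ≤ N →
        (triSitePercolation half).real (G (2 * m + 1) N) ≤ C₁ * (triSitePercolation half).real (sepArmsOn κ s m N))) :
    ∃ C : ℝ, 0 < C ∧ ∃ n₀ : ℕ, ∀ n N : ℕ, n₀ ≤ n → 2 * n ≤ N →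
      (triSitePercolation half).real (extArmsOn κ s n N) ≤ C * (triSitePercolation half).real (sepArmsOn κ s n N) := by
  classical
  set μ := triSitePercolation half with hμ
  have hP1 : ∀ t : Set (SiteConfig (Site 2)), μ.real t ≤ 1 := fun t => measureReal_le_one
  have hP0 : ∀ t : Set (SiteConfig (Site 2)), 0 ≤ μ.real t := fun t => measureReal_nonneg
  -- the extension constant `C₀`
  obtain ⟨c₁, hc₁, hext⟩ := exists_real_sepArmsOn_mul_le_inward κ s hs
  set c₁' : ℝ := min c₁ 1 with hc₁'
  have hc₁'0 : 0 < c₁' := lt_min hc₁ one_pos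
  have hc₁'1 : c₁' ≤ 1 := min_le_right _ _
  set C₀ : ℝ := 1 / c₁' with hC₀
  have hC₀1 : 1 ≤ C₀ := by rw [hC₀, le_div_iff₀ hc₁'0, one_mul]; exact hc₁'1
  have hC₀0 : 0 < C₀ := lt_of_lt_of_le one_pos hC₀1
  have hextC : ∀ m m' N, 1100 ≤ m' → 2 * m' + 1 ≤ m → m ≤ 3 * m' → 2 * m ≤ N →
      μ.real (sepArmsOn κ s m N) ≤ C₀ * μ.real (sepArmsOn κ s m' N) := by
    intro m m' N h1 h2 h3 h4
    rw [hC₀, one_div, ← div_eq_inv_mul, le_div_iff₀ hc₁'0]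
    exact (mul_le_mul_of_nonneg_left (min_le_left _ _) (hP0 _)).trans (hext m m' N h1 h2 h3 h4)
  -- the failure rate
  set ε : ℝ := 1 / (2 * C₀ ^ 2) with hε
  have hε0 : 0 < ε := by positivity
  have hεC : ε * C₀ ^ 2 ≤ 1 / 2 := by
    have hne : C₀ ≠ 0 := hC₀0.ne'
    have e : ε * C₀ ^ 2 = 1 / 2 := by rw [hε]; field_simp
    rw [e]
  obtain ⟨G, C₁, n₁, hC₁, hstep, hland⟩ := hIn ε hε0
  -- the initial estimate
  obtain ⟨ci, hci0, hinit⟩ := exists_le_real_sepArmsOn_smallRatio κ s hs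
  have hCc : 1 / ci ≤ 2 * C₁ + 1 / ci := by linarith
  refine ⟨2 * C₁ + 1 / ci, by positivity, n₁ + 1100, fun n N hn hN => ?_⟩
  have hn1100 : 1100 ≤ n := le_trans (Nat.le_add_left _ _) hn
  have hnn₁ : n₁ ≤ n := le_trans (Nat.le_add_right _ _) hn
  by_cases h10 : N ≤ 10 * n
  · -- few scales: the initial estimate directly
    have h1 := hinit n N hn1100 hN (by omega)
    calc μ.real (extArmsOn κ s n N) ≤ 1 := hP1 _
      _ ≤ 1 / ci * μ.real (sepArmsOn κ s n N) := by rw [one_div_mul_eq_div, le_div_iff₀ hci0, one_mul]; exact h1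
      _ ≤ (2 * C₁ + 1 / ci) * μ.real (sepArmsOn κ s n N) := mul_le_mul_of_nonneg_right hCc (hP0 _)
  push Not at h10
  -- the number of rungs
  have hn0 : 0 < n + 1 := Nat.succ_pos n
  set qq := (N + 2) / (n + 1) with hqq
  have hq8 : 8 ≤ qq := (Nat.le_div_iff_mul_le hn0).2 (by omega)
  obtain ⟨e, he1, he2⟩ : ∃ e, 2 ^ e ≤ qq ∧ qq < 2 ^ (e + 1) :=
    ⟨Nat.log 2 qq, Nat.pow_log_le_self 2 (by omega), Nat.lt_pow_succ_log_self one_lt_two _⟩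
  have he3 : 3 ≤ e := by
    by_contra h
    push Not at h
    have : 2 ^ (e + 1) ≤ 8 := by
      calc 2 ^ (e + 1) ≤ 2 ^ 3 := Nat.pow_le_pow_right (by norm_num) (by omega)
        _ = 8 := by norm_num
    omega
  obtain ⟨J, rfl⟩ : ∃ J, e = J + 1 := ⟨e - 1, by omega⟩
  obtain ⟨J', hJ'⟩ : ∃ J', J = J' + 1 := ⟨J - 1, by omega⟩
  have hX1 : (n + 1) * 2 ^ (J + 1) ≤ N + 2 := by
    have := (Nat.le_div_iff_mul_le hn0).1 he1; rw [Nat.mul_comm]; exact this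
  have hX2 : N + 2 < (n + 1) * 2 ^ (J + 1 + 1) := by
    have := (Nat.div_lt_iff_lt_mul hn0).1 he2; rw [Nat.mul_comm]; exact this
  -- the extreme rungs
  have h2mJ : 2 * inRad n J ≤ N := by have := two_mul_inRad n J; omega
  have hinitJ : N ≤ 10 * inRad n J' := by
    have h1 := two_mul_inRad n J'
    rw [← hJ'] at h1
    have h2 : (n + 1) * 2 ^ (J + 1 + 1) = 4 * ((n + 1) * 2 ^ J) := by rw [pow_succ, pow_succ]; ring
    have h3 := le_inRad n J'
    omega
  have hrad : ∀ i, i + 1 ≤ J → inRad n (J - i) = 2 * inRad n (J - (i + 1)) + 1 := fun i hi => by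
    rw [show J - i = J - (i + 1) + 1 by omega, inRad_succ]
  have hradJ : ∀ j, j ≤ J → 2 * inRad n j ≤ N := fun j hj => by have := inRad_mono n hj; omega
  -- the scheme, read inward: index `i` ↦ radius `m_{J-i}`
  have key := le_mul_of_separationScheme_upto
    (f := fun i => μ.real (extArmsOn κ s (inRad n (J - i)) N))
    (g := fun i => μ.real (G (inRad n (J - i)) N))
    (h := fun i => μ.real (sepArmsOn κ s (inRad n (J - i)) N))
    (k := 0) (L := J) (ε := ε) (C₀ := C₀) (C₁ := C₁) (c := ci) hε0.le hC₀1 hC₁ hci0 hεC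
    (fun _ => hP1 _) (fun _ => hP0 _) (by omega)
    (fun i _ hiJ => ?_) (fun i _ hiJ => ?_) (fun i hi1 hiJ => ?_) (fun i hi1 hiJ => ?_) ?_ J (by omega) le_rfl
  · simpa only [Nat.sub_self, inRad_zero] using key
  · -- monotonicity in the inner radius
    show μ.real (extArmsOn κ s (inRad n (J - (i + 1))) N) ≤ μ.real (extArmsOn κ s (inRad n (J - i)) N)
    refine measureReal_mono (extArmsOn_mono κ s (inRad_mono n (by omega)) ?_) (measure_ne_top _ _)
    have := hradJ (J - i) (by omega); omega
  · -- the inward surgery at the rung `m = m_{J-i-1}`, `2m+1 = m_{J-i}`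
    set m := inRad n (J - (i + 1)) with hm
    show μ.real (extArmsOn κ s m N) ≤ μ.real (G m N) + ε * μ.real (extArmsOn κ s (inRad n (J - i)) N)
    rw [hrad i hiJ]
    have hmn : n ≤ m := le_inRad n _
    have hm2 : 2 * (2 * m + 1) ≤ N := by rw [← hrad i hiJ]; exact hradJ _ (by omega)
    exact hstep m N (hnn₁.trans hmn) hm2
  · -- the landing of the rung `m_{J-i} = 2 m_{J-i-1} + 1` onto `∂Λ_{m_{J-i-1}}`
    set m := inRad n (J - (i + 1)) with hm
    show μ.real (G (inRad n (J - i)) N) ≤ C₁ * μ.real (sepArmsOn κ s m N)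
    rw [hrad i hiJ]
    have hmn : n ≤ m := le_inRad n _
    have hm2 : 2 * (2 * m + 1) ≤ N := by rw [← hrad i hiJ]; exact hradJ _ (by omega)
    exact hland m N (hnn₁.trans hmn) hm2
  · -- the inward extension
    show μ.real (sepArmsOn κ s (inRad n (J - i)) N) ≤ C₀ * μ.real (sepArmsOn κ s (inRad n (J - (i + 1))) N)
    have h1 := le_inRad n (J - (i + 1))
    have hm' : 1100 ≤ inRad n (J - (i + 1)) := by omega
    have hmm : 2 * inRad n (J - (i + 1)) + 1 ≤ inRad n (J - i) := by rw [hrad i hiJ]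
    have hm3 : inRad n (J - i) ≤ 3 * inRad n (J - (i + 1)) := by rw [hrad i hiJ]; omega
    have hNN : 2 * inRad n (J - i) ≤ N := hradJ _ (by omega)
    exact hextC _ _ N hm' hmm hm3 hNN
  · -- the initial scale `m_{J-1}`
    show ci ≤ μ.real (sepArmsOn κ s (inRad n (J - (0 + 1))) N)
    rw [show J - (0 + 1) = J' by omega]
    have h1 := le_inRad n J'
    exact hinit (inRad n J') N (by omega) (hradJ _ (by omega)) (by omega)

/-! ### Both halves: the separation hypothesis and quasi-multiplicativity -/

/-- **Arm separation for an arbitrary pattern from the two surgeries** (Nolin 2008, Thm. 11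
[arXiv 0711.4948: Thm. 10] at `p = 1/2`, modulo its two pattern-specific inputs): if the external
surgery-and-landing holds for the arm event `armEvent κ` toward `extArmsOn κ s` and the internal
one holds from `extArmsOn κ s` toward `sepArmsOn κ s` (hypotheses as in the two theorems above),
then `c · polyArmProb κ n N ≤ P_{1/2}(sepArmsOn κ s n N)` for `n ≥ n₀`, `N ≥ 2n` — the hypothesis
`hsep` of `polyArmProb_quasiMult_of_sepArmsOn_separation`. [cite: Nolin2008, §4.4 Thm. 11 (arXiv 0711.4948: Thm. 10, pp. 11–13)] -/
theorem sepArmsOn_separation_of_surgeries (κ : Fin k → Bool) (s : Fin k → Fin 6) (hs : Function.Injective s)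
    (hOut : ∀ ε : ℝ, 0 < ε → ∃ (G : ℕ → ℕ → Set (SiteConfig (Site 2))) (C₁ : ℝ) (n₀ : ℕ), 0 ≤ C₁ ∧
      (∀ n M : ℕ, n₀ ≤ n → 2 * n ≤ M →
        (triSitePercolation half).real (armEvent κ n (2 * M)) ≤
          (triSitePercolation half).real (G n M) + ε * (triSitePercolation half).real (armEvent κ n M)) ∧
      (∀ n M : ℕ, n₀ ≤ n → 2 * n ≤ M →
        (triSitePercolation half).real (G n M) ≤ C₁ * (triSitePercolation half).real (extArmsOn κ s n (4 * M))))
    (hIn : ∀ ε : ℝ, 0 < ε → ∃ (G : ℕ → ℕ → Set (SiteConfig (Site 2))) (C₁ : ℝ) (n₀ : ℕ), 0 ≤ C₁ ∧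
      (∀ m N : ℕ, n₀ ≤ m → 2 * (2 * m + 1) ≤ N →
        (triSitePercolation half).real (extArmsOn κ s m N) ≤
          (triSitePercolation half).real (G m N) + ε * (triSitePercolation half).real (extArmsOn κ s (2 * m + 1) N)) ∧
      (∀ m N : ℕ, n₀ ≤ m → 2 * (2 * m + 1) ≤ N →
        (triSitePercolation half).real (G (2 * m + 1) N) ≤ C₁ * (triSitePercolation half).real (sepArmsOn κ s m N))) :
    ∃ c : ℝ, 0 < c ∧ ∃ n₀ : ℕ, ∀ n N : ℕ, n₀ ≤ n → 2 * n ≤ N →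
      c * polyArmProb κ n N ≤ (triSitePercolation half).real (sepArmsOn κ s n N) := by
  obtain ⟨C, hC, n₁, h1⟩ := exists_real_le_mul_extArmsOn_of_outerSurgery κ s hs (armEvent κ)
    (fun n R R' hR hRR' => armEvent_mono_holds κ (by omega) hRR') hOut
  obtain ⟨C', hC', n₂, h2⟩ := exists_real_extArmsOn_le_mul_sepArmsOn_of_innerSurgery κ s hs hIn
  refine ⟨1 / (C * C'), by positivity, max n₁ n₂, fun n N hn hN => ?_⟩
  have e1 := h1 n N (le_trans (le_max_left _ _) hn) hN
  have e2 := h2 n N (le_trans (le_max_right _ _) hn) hN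
  unfold polyArmProb
  rw [one_div, inv_mul_eq_div, div_le_iff₀ (by positivity)]
  calc (triSitePercolation half).real (armEvent κ n N) ≤ C * (triSitePercolation half).real (extArmsOn κ s n N) := e1
    _ ≤ C * (C' * (triSitePercolation half).real (sepArmsOn κ s n N)) := mul_le_mul_of_nonneg_left e2 hC.le
    _ = (triSitePercolation half).real (sepArmsOn κ s n N) * (C * C') := by ring

/-- **Quasi-multiplicativity of `polyArmProb κ` from the two surgeries** (Nolin 2008, Prop. 17
[arXiv 0711.4948: Prop. 16] for the pattern `κ`, modulo the two pattern-specific inputs of Thm. 11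
on the sides `s`): `sepArmsOn_separation_of_surgeries` fed to
`polyArmProb_quasiMult_of_sepArmsOn_separation`. The conclusion is the clause of
`Nolin2008_prop17_quasiMult` at `κ`. [cite: Nolin2008, §4.5 Prop. 17 and §4.4 Thm. 11 (arXiv 0711.4948: Prop. 16, Thm. 10)] -/
theorem polyArmProb_quasiMult_of_surgeries (κ : Fin k → Bool) (s : Fin k → Fin 6) (hs : Function.Injective s)
    (hOut : ∀ ε : ℝ, 0 < ε → ∃ (G : ℕ → ℕ → Set (SiteConfig (Site 2))) (C₁ : ℝ) (n₀ : ℕ), 0 ≤ C₁ ∧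
      (∀ n M : ℕ, n₀ ≤ n → 2 * n ≤ M →
        (triSitePercolation half).real (armEvent κ n (2 * M)) ≤
          (triSitePercolation half).real (G n M) + ε * (triSitePercolation half).real (armEvent κ n M)) ∧
      (∀ n M : ℕ, n₀ ≤ n → 2 * n ≤ M →
        (triSitePercolation half).real (G n M) ≤ C₁ * (triSitePercolation half).real (extArmsOn κ s n (4 * M))))
    (hIn : ∀ ε : ℝ, 0 < ε → ∃ (G : ℕ → ℕ → Set (SiteConfig (Site 2))) (C₁ : ℝ) (n₀ : ℕ), 0 ≤ C₁ ∧
      (∀ m N : ℕ, n₀ ≤ m → 2 * (2 * m + 1) ≤ N →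
        (triSitePercolation half).real (extArmsOn κ s m N) ≤
          (triSitePercolation half).real (G m N) + ε * (triSitePercolation half).real (extArmsOn κ s (2 * m + 1) N)) ∧
      (∀ m N : ℕ, n₀ ≤ m → 2 * (2 * m + 1) ≤ N →
        (triSitePercolation half).real (G (2 * m + 1) N) ≤ C₁ * (triSitePercolation half).real (sepArmsOn κ s m N))) :
    ∃ c : ℝ, 0 < c ∧ ∃ n₀ : ℕ, ∀ n₁ n₂ n₃ : ℕ, n₀ ≤ n₁ → n₁ < n₂ → n₂ < n₃ →
      c * (polyArmProb κ n₁ n₂ * polyArmProb κ n₂ n₃) ≤ polyArmProb κ n₁ n₃ :=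
  polyArmProb_quasiMult_of_sepArmsOn_separation κ s hs (sepArmsOn_separation_of_surgeries κ s hs hOut hIn)

end Literature.Probability.Percolation

end
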